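import Summits.ResolutionOfSingularities.ResolutionOfSingularities.Theorems.FrobeniusClosingPatchingRelPerfectDepthSNCSwap
import Summits.ResolutionOfSingularities.ResolutionOfSingularities.Theorems.FrobeniusClosingPatchingRelPerfectDepthSNCJointMultiplicity
import Literature.AlgebraicGeometry.Resolution.HypersurfacePushforward
import Literature.AlgebraicGeometry.Resolution.StalkIdealLemmas
import Literature.AlgebraicGeometry.Resolution.EffectiveCartierStalks
import Literature.AlgebraicGeometry.Resolution.RegularLocalRingsQuotient
import HarnessLib

/-!
# Crux `PatchingRelPerfect` (stmt-ResolutionOfSingularities-16161), chain W5.2 — END-SNC at points of `i(E)`: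
# the host lifted at a COINCIDENCE point (host trace = trace of a boundary member)

[OURS · L1 W5.2 · rung tool] Replaces the role of NO printed item; NOT a statement of the manuscript under review; fact-free.
res-D-pv-052's `DepthRetract.sncWithAt_host_cons` (…DepthBoundaryLiftPointwise) lifts E-side simple normal crossings of
`D′ :: ℬ` to `𝓐 :: 𝓘_E :: 𝒢` at `i y` when the host trace `D′` is NOT a boundary member. F6 stage 2 (res-L1-w52-plan-1
TargetsF6 part S: `SepJointAt`, `EndSep`, `CoincidesAt`) also meets the other case: at `y` the host trace COINCIDES with the trace
`B = G|_E` of a boundary member `G` (`B_y = 𝔟_y`) and has order one (`OrdLeOneAt`: `𝔟_y ⊄ 𝔪_y²`). Then the host is inserted by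
the COINCIDENCE SWAP (`DepthSNC.SNCWithAt.coincidence_swap`, …DepthSNCSwap): `h ∈ G_x + (𝓘_E)_x` from the trace coincidence
(lift a unit of `𝒪_{E,y}` through the surjection `𝒪_{X,i y} → 𝒪_{E,y}` with kernel `(𝓘_E)_x = (t)`), and `h ∉ (𝓘_E)_x + 𝔪_x²`
from order one of the trace; the member `G` is swapped OUT, every other member is kept.

* `mem_sup_of_trace_eq` — `(G|_E)_y = (𝓗|_E)_y ⇒ h ∈ G_x ⊔ (ker i)_x` for generators `h` of `𝓗_x`;
* `not_mem_ker_sup_sq_of_trace_order_one` — `(𝓗|_E)_y ⊄ 𝔪_y² ⇒ h ∉ (ker i)_x ⊔ 𝔪_x²`;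
* **`sncWithAt_host_cons_of_coincidence`** — `SNCWithAt (𝓘_E :: 𝒢) C (i y)` + coincidence with `G ∈ 𝒢` + order one +
  `G_x ⊆ C_x`, `h ∈ C_x` ⇒ `SNCWithAt (𝓗 :: 𝓘_E :: L′) C (i y)` for `L′ ⊆ 𝒢 ∖ {G}`; `…_top` the centre-free END form.

## References
* J. Kollár, *Lectures on Resolution of Singularities* (2007), Cor. 3.85, (3.111) Step 3. [Kollar2007]
* H. Matsumura, *Commutative Ring Theory* (1986), Thm. 14.2. [Matsumura1987]
-/

-- `Summit.<Summit>.<Sub>.Theorems` with `Sub = Summit` (single-conjunct summit, D-0017)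
set_option linter.dupNamespace false

noncomputable section

open CategoryTheory CategoryTheory.Limits AlgebraicGeometry TopologicalSpace IsLocalRing
open Literature.AlgebraicGeometry.Resolution

namespace Summit.ResolutionOfSingularities.ResolutionOfSingularities.Theorems

universe u

namespace DepthSNC

variable {E X : Scheme.{u}} (i : E ⟶ X) [IsClosedImmersion i] (y : E)

/-- **Trace coincidence lifts to `h ∈ G_x + (ker i)_x`.** If the traces of `G` and `𝓗` have the same stalk at `y` and
`𝓗_{i y} = (h)`, then `h ∈ G_{i y} ⊔ (ker i)_{i y}` (`𝒪_{E,y}` a domain: equal principal ideals have associated generators;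
lift the unit's preimage through the surjection `𝒪_{X, i y} → 𝒪_{E, y}`, whose kernel is `(ker i)_{i y}`). [cite: Matsumura1987, Thm. 14.2] -/
theorem mem_sup_of_trace_eq [IsDomain (E.presheaf.stalk y)] {𝓗 G : X.IdealSheafData}
    (hco : stalkIdeal (G.comap i) y = stalkIdeal (𝓗.comap i) y) {h g : X.presheaf.stalk (i.base y)}
    (h𝓗 : stalkIdeal 𝓗 (i.base y) = Ideal.span {h}) (hGg : stalkIdeal G (i.base y) = Ideal.span {g}) :
    h ∈ stalkIdeal G (i.base y) ⊔ stalkIdeal i.ker (i.base y) := by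
  set q := (i.stalkMap y).hom with hqdef
  have hq : Function.Surjective q := i.stalkMap_surjective y
  rw [stalkIdeal_comap_eq_map_stalkMap, stalkIdeal_comap_eq_map_stalkMap, hGg, h𝓗, Ideal.map_span, Ideal.map_span,
    Set.image_singleton, Set.image_singleton] at hco
  change Ideal.span {q g} = Ideal.span {q h} at hco
  obtain ⟨ubar, hubar⟩ := Ideal.span_singleton_eq_span_singleton.mp hco
  obtain ⟨w, hw⟩ := hq (ubar : E.presheaf.stalk y)
  -- `q (h - g w) = 0`, so `h - g w ∈ (ker i)_x`
  have hker : h - g * w ∈ stalkIdeal i.ker (i.base y) := by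
    rw [← ker_stalkMap_of_isClosedImmersion i y, RingHom.mem_ker]
    change q (h - g * w) = 0
    rw [map_sub, map_mul, hw, hubar, sub_self]
  have : h = g * w + (h - g * w) := by ring
  rw [this]
  exact Ideal.add_mem _ (Ideal.mem_sup_left (hGg ▸ Ideal.mul_mem_right _ _ (Ideal.mem_span_singleton_self g)))
    (Ideal.mem_sup_right hker)

/-- **Order one of the trace forbids `h ∈ (ker i)_x + 𝔪_x²`**: the surjection `𝒪_{X, i y} → 𝒪_{E, y}` kills `(ker i)_x` and
maps `𝔪_x²` onto `𝔪_y²`. [cite: Matsumura1987, Thm. 14.2] -/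
theorem not_mem_ker_sup_sq_of_trace_order_one {𝓗 : X.IdealSheafData} {h : X.presheaf.stalk (i.base y)}
    (h𝓗 : stalkIdeal 𝓗 (i.base y) = Ideal.span {h})
    (hord : ¬ stalkIdeal (𝓗.comap i) y ≤ maximalIdeal (E.presheaf.stalk y) ^ 2) :
    h ∉ stalkIdeal i.ker (i.base y) ⊔ maximalIdeal (X.presheaf.stalk (i.base y)) ^ 2 := by
  intro hmem
  apply hord
  set q := (i.stalkMap y).hom with hqdef
  have hq : Function.Surjective q := i.stalkMap_surjective y
  rw [stalkIdeal_comap_eq_map_stalkMap, h𝓗, Ideal.map_span, Set.image_singleton, Ideal.span_singleton_le_iff_mem]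
  change q h ∈ _
  obtain ⟨k, hk, r, hr, hkr⟩ := Submodule.mem_sup.mp hmem
  have hqk : q k = 0 := by
    rw [← RingHom.mem_ker, ker_stalkMap_of_isClosedImmersion i y]; exact hk
  rw [← hkr, map_add, hqk, zero_add, ← map_maximalIdeal_of_surjective q hq, ← Ideal.map_pow]
  exact Ideal.mem_map_of_mem q hr

/-- [OURS · L1 W5.2] **THE HOST LIFTED AT A COINCIDENCE POINT.** `i : E ⟶ X` a closed immersion with `𝓘_E = ker i`,
`𝓗` an effective Cartier ideal sheaf (the host), `SNCWithAt (𝓘_E :: 𝒢) C (i y)` (the boundary lifted, res-D-pv-052's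
`sncWithAt_cons_lift`), a member `G ∈ 𝒢` through `i y` whose trace COINCIDES with the host trace at `y`
(`(G|_E)_y = (𝓗|_E)_y`), the host trace of ORDER ONE at `y`, `G_x ⊆ C_x` and `𝓗_x ⊆ C_x`. Then `𝓗 :: 𝓘_E :: L′` has simple normal
crossings with `C` at `i y` for every list `L′` of members of `𝒢` other than `G` (the charged carriers, say).
[cite: Kollar2007, Cor. 3.85] -/
theorem sncWithAt_host_cons_of_coincidence {𝒢 : List X.IdealSheafData} {C : X.IdealSheafData}
    (hX : SNCWithAt (i.ker :: 𝒢) C (i.base y)) {𝓗 : X.IdealSheafData} (h𝓗 : IsEffectiveCartier 𝓗)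
    {G : X.IdealSheafData} (hG : G ∈ 𝒢) (hxG : i.base y ∈ G.support)
    (hco : stalkIdeal (G.comap i) y = stalkIdeal (𝓗.comap i) y)
    (hord : ¬ stalkIdeal (𝓗.comap i) y ≤ maximalIdeal (E.presheaf.stalk y) ^ 2)
    (hGC : stalkIdeal G (i.base y) ≤ stalkIdeal C (i.base y)) (h𝓗C : stalkIdeal 𝓗 (i.base y) ≤ stalkIdeal C (i.base y))
    {L' : List X.IdealSheafData} (hL' : ∀ D ∈ L', i.base y ∈ D.support → D ∈ 𝒢 ∧ D ≠ G) :
    SNCWithAt (𝓗 :: i.ker :: L') C (i.base y) := by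
  classical
  haveI := hX.isRegularLocalRing
  have hxE : i.base y ∈ i.ker.support := apply_mem_support_ker i y
  have hsqE := hX.not_stalkIdeal_le_sq (List.mem_cons_self) hxE
  have hX' := hX
  obtain ⟨hreg, d, v, hd, hv, ⟨ι, hι, hιD⟩, -⟩ := hX'
  obtain ⟨h, hh, h𝓗x⟩ := h𝓗.exists_stalkIdeal_eq_span (i.base y)
  set g := v (ι ⟨G, List.mem_cons_of_mem _ hG, hxG⟩) with hgdef
  have hGg : stalkIdeal G (i.base y) = Ideal.span {g} := hιD ⟨G, List.mem_cons_of_mem _ hG, hxG⟩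
  -- `G ≠ ker i`: otherwise the host trace would be zero at `y`, contradicting order one
  have hGne : i.ker ≠ G := by
    intro hkG
    apply hord
    rw [← hco, ← hkG, stalkIdeal_comap_eq_map_stalkMap]
    refine Ideal.map_le_iff_le_comap.mpr fun a ha => ?_
    rw [← ker_stalkMap_of_isClosedImmersion i y] at ha
    rw [Ideal.mem_comap, RingHom.mem_ker.mp ha]
    exact Ideal.zero_mem _
  -- the host passes through `x`
  have hx𝓗 : i.base y ∈ 𝓗.support := by
    have hy : y ∈ (𝓗.comap i).support := by
      rw [mem_support_iff_stalkIdeal_le, ← hco, ← mem_support_iff_stalkIdeal_le, Scheme.IdealSheafData.support_comap]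
      exact hxG
    rwa [Scheme.IdealSheafData.support_comap] at hy
  -- regularity of `𝒪_{E,y}`: from the snc member `ker i` (`𝒪_{X,x}/(t)` regular, `t ∉ 𝔪²`)
  haveI : IsDomain (E.presheaf.stalk y) := by
    have ht : stalkIdeal i.ker (i.base y) = Ideal.span {v (ι ⟨i.ker, List.mem_cons_self, hxE⟩)} :=
      hιD ⟨i.ker, List.mem_cons_self, hxE⟩
    have hkerq : RingHom.ker (i.stalkMap y).hom = Ideal.span {v (ι ⟨i.ker, List.mem_cons_self, hxE⟩)} := by
      rw [ker_stalkMap_of_isClosedImmersion i y]; exact ht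
    have ht2 := hsqE
    rw [ht, Ideal.span_singleton_le_iff_mem] at ht2
    have ht𝔪 : v (ι ⟨i.ker, List.mem_cons_self, hxE⟩) ∈ maximalIdeal _ := by
      rw [← hv]; exact Ideal.subset_span ⟨_, rfl⟩
    haveI : IsRegularLocalRing ((X.presheaf.stalk (i.base y)) ⧸ Ideal.span {v (ι ⟨i.ker, List.mem_cons_self, hxE⟩)}) :=
      (IsRegularLocalRing.quotient_span_singleton ht𝔪 ht2).1
    let e : (X.presheaf.stalk (i.base y)) ⧸ Ideal.span {v (ι ⟨i.ker, List.mem_cons_self, hxE⟩)} ≃+*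
        E.presheaf.stalk y :=
      (Ideal.quotEquivOfEq hkerq.symm).trans (RingHom.quotientKerEquivOfSurjective (i.stalkMap_surjective y))
    haveI : IsRegularLocalRing (E.presheaf.stalk y) := IsRegularLocalRing.of_ringEquiv e
    exact isDomain_of_isRegularLocalRing _
  have hin : h ∈ stalkIdeal i.ker (i.base y) ⊔ stalkIdeal G (i.base y) := by
    rw [sup_comm]; exact mem_sup_of_trace_eq i y hco h𝓗x hGg
  have hout := not_mem_ker_sup_sq_of_trace_order_one i y h𝓗x hord
  refine hX.coincidence_swap (A := G) (L' := i.ker :: L') (List.mem_cons_of_mem _ hG) hxG hGC hx𝓗 h𝓗x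
    (h𝓗C (h𝓗x ▸ Ideal.mem_span_singleton_self h)) (G := i.ker) List.mem_cons_self hxE hGne hin hout ?_
  intro D hD hxD
  rcases List.mem_cons.mp hD with rfl | hDL'
  · exact ⟨List.mem_cons_self, hGne⟩
  · exact ⟨List.mem_cons_of_mem _ (hL' D hDL' hxD).1, (hL' D hDL' hxD).2⟩

/-- [OURS · L1 W5.2] **The END form** (centre `⊤`): F6 stage 2's `EndSep` at a point where the host trace coincides with a
boundary trace (`CoincidesAt`) and has order one (`OrdLeOneAt`). [cite: Kollar2007, (3.111) Step 3] -/
theorem sncWithAt_host_cons_of_coincidence_top {𝒢 : List X.IdealSheafData}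
    (hX : SNCWithAt (i.ker :: 𝒢) ⊤ (i.base y)) {𝓗 : X.IdealSheafData} (h𝓗 : IsEffectiveCartier 𝓗)
    {G : X.IdealSheafData} (hG : G ∈ 𝒢) (hxG : i.base y ∈ G.support)
    (hco : stalkIdeal (G.comap i) y = stalkIdeal (𝓗.comap i) y)
    (hord : ¬ stalkIdeal (𝓗.comap i) y ≤ maximalIdeal (E.presheaf.stalk y) ^ 2)
    {L' : List X.IdealSheafData} (hL' : ∀ D ∈ L', i.base y ∈ D.support → D ∈ 𝒢 ∧ D ≠ G) :
    SNCWithAt (𝓗 :: i.ker :: L') ⊤ (i.base y) :=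
  sncWithAt_host_cons_of_coincidence i y hX h𝓗 hG hxG hco hord (by rw [stalkIdeal_top]; exact le_top)
    (by rw [stalkIdeal_top]; exact le_top) hL'

end DepthSNC

end Summit.ResolutionOfSingularities.ResolutionOfSingularities.Theorems

end
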